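import Mathlib
import Literature.NumberTheory.Transcendental.KZLogCalculusProofs
import HarnessLib

/-!
# Fibred substitution along the last coordinate — a derived move of the Kontsevich–Zagier calculus

Theorem-only support file for the calculus of moves of `KZCalculus.lean` (`KZ.IntegralRep`,
`KZ.FormalRep`, `KZ.of`, the four move sets, `KZ.relations`) and its bands
`KZlog.band G a b = {(y, s) | y ∈ G, a y ≤ s ≤ b y}` (`KZLogCalculus.lean`), companion to the
**affine** substitution along the last coordinate `KZ.of_sub_of_mem_relations_of_affine` of
`KZLogCalculusProofs.lean`:

* `KZ.of_sub_of_mem_relations_of_fibreMap` — **fibred `C¹` substitution along the last coordinate.**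
  Over a `ℚ`-semialgebraic base `G ⊆ ℝᵐ` with edges `a ≤ b`, let `r` live on `band G a b` and `r'` on
  `band G a' b'`; let `ψ` be `ℚ`-semialgebraic on `r.domain`, differentiable at its points, with
  `∂ψ/∂s = ψs > 0` there and `ψ (y, a y) = a' y`, `ψ (y, b y) = b' y`. If
  `r.integrand (y, s) = r'.integrand (y, ψ (y, s)) · ψs (y, s)` on `r.domain`, then `[r] − [r']` is ONE
  instance of Kontsevich–Zagier's rule 2) [Kontsevich–Zagier 2001, §1.2] along
  `Φ (y, s) = (y, ψ (y, s))`: `Φ` is injective on the band and onto the second band fibrewise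
  (strict monotonicity, `strictMonoOn_of_deriv_pos`, and the intermediate value theorem), with
  Jacobian determinant `∂ψ/∂s` (`LinearMap.det_of_snoc_init`, Laplace expansion along the last
  column). The affine move is the case `ψ (y, s) = α y + β y · s` (there over an open base).
* `eq_snoc_init_zero_add` (private helper) — `w = (init w, 0) + w_last · e_last`, the splitting used
  for the determinant.

Provenance. Typed for the root decomposition cell `decomp-kz` of `KontsevichZagierPeriods`
(lens 2, generation 4), where the move carries the first rung of the crux `PiRationalisation`
(route RootDecompRationalCubeDichotomy, item 24903: the doubling substitution `σ = 2t/(1+2t−t²)` and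
the fibred Möbius substitution are its instances `m = 0`, `m = 1`). Source, kernel-checked there
(rc 0, no placeholders, standard axioms) and copied verbatim modulo the namespace:
`run/shared/lean/pub/decomp-kz/decomp-kz-lens-2/g4/RationalCubeDichotomy.lean` v5
(sha256 `eccce7f41a30381a…`), lines 1698–1880 (`of_sub_of_mem_relations_of_fibreMap` at l. 1715)
= `…/g4/FibreMapScratch.lean` (sha256 `2938dfa6256b4963…`), ll. 26–210. A summit-side copy lives in
`Summits/KontsevichZagierPeriods/KontsevichZagierPeriods/Theorems/RootDecompRationalCubeDichotomyPiRationalisationSqrtMoves.lean`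
(namespace `Summit.KontsevichZagierPeriods.RootDecompRationalCubeDichotomy.Rung24903`); this file is
the importable Literature home of the move.

Everything is proved; no `def`, no named fact.

## References

* M. Kontsevich, D. Zagier, *Periods*, in: Mathematics Unlimited — 2001 and Beyond, Springer
  (2001), §1.2, rule 2) (change of variables). [`KontsevichZagier2001`]
-/

noncomputable section

open MeasureTheory Set MvPolynomial

namespace Literature.NumberTheory.Transcendental

open Literature.ModelTheory.ExponentialFields (IsSemialgebraic)

namespace KZ

/-! ### The move -/

/-- `w = snoc (init w) 0 + w_last • (0,…,0,1)`: the splitting of `ℝᵐ⁺¹ = ℝᵐ × ℝ` used in the Jacobian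
computation of `KZ.of_sub_of_mem_relations_of_fibreMap`. (Source: cell `decomp-kz`, lens 2 gen 4,
`RationalCubeDichotomy.lean` v5, sha256 `eccce7f4…`, l. 1699.) [folklore] -/
private theorem eq_snoc_init_zero_add (m : ℕ) (w : Fin (m + 1) → ℝ) :
    w = Fin.snoc (Fin.init w) (0 : ℝ) + w (Fin.last m) • (Pi.single (Fin.last m) (1 : ℝ) : Fin (m + 1) → ℝ) := by
  ext i
  refine Fin.lastCases ?_ (fun j => ?_) i
  · simp
  · simp [(Fin.castSucc_lt_last j).ne, Fin.init]

/-- **Fibred substitution along the last coordinate is a change-of-variables move.** Over a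
`ℚ`-semialgebraic base `G ⊆ ℝᵐ` with edges `a ≤ b`, let `r` live on the band `{(y,s) | y ∈ G, a y ≤ s ≤ b y}` and
`r'` on the band with edges `a'`, `b'`. Let `ψ` be `ℚ`-semialgebraic on `r.domain`, differentiable at its points,
with `∂ψ/∂s = ψs > 0` there, and `ψ (y, a y) = a' y`, `ψ (y, b y) = b' y`. If
`r.integrand (y, s) = r'.integrand (y, ψ (y, s)) · ψs (y, s)` on `r.domain`, then `[r] − [r']` is an instance of
Kontsevich–Zagier's rule 2) along `Φ (y, s) = (y, ψ (y, s))` (injective and onto the second band fibrewise by strict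
monotonicity and the intermediate value theorem; Jacobian determinant `∂ψ/∂s` by Laplace expansion), hence a
relation. Generalises `KZ.of_sub_of_mem_relations_of_affine` (`ψ = α + β s`). (Source: cell `decomp-kz`,
lens 2 gen 4, `RationalCubeDichotomy.lean` v5, sha256 `eccce7f4…`, l. 1715 = `FibreMapScratch.lean` l. 43;
summit-side copy `Theorems/RootDecompRationalCubeDichotomyPiRationalisationSqrtMoves.lean`.)
[cite: KontsevichZagier2001, §1.2 rule 2] -/
theorem of_sub_of_mem_relations_of_fibreMap {m : ℕ} {G : Set (Fin m → ℝ)}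
    {a b a' b' : (Fin m → ℝ) → ℝ} (ψ ψs : (Fin (m + 1) → ℝ) → ℝ)
    (r r' : IntegralRep (m + 1)) (hr : r.domain = KZlog.band G a b)
    (hr' : r'.domain = KZlog.band G a' b') (hab : ∀ y ∈ G, a y ≤ b y)
    (hψ : IsSemialgebraicFunOn ℚ r.domain ψ)
    (hψd : ∀ z ∈ r.domain, DifferentiableAt ℝ ψ z)
    (hψs : ∀ z ∈ r.domain,
      HasDerivAt (fun t : ℝ => ψ (Fin.snoc (Fin.init z) t)) (ψs z) (z (Fin.last m)))
    (hpos : ∀ z ∈ r.domain, 0 < ψs z)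
    (ha : ∀ y ∈ G, ψ (Fin.snoc y (a y)) = a' y) (hb : ∀ y ∈ G, ψ (Fin.snoc y (b y)) = b' y)
    (hint : ∀ z ∈ r.domain, r.integrand z = r'.integrand (Fin.snoc (Fin.init z) (ψ z)) * ψs z) :
    of r - of r' ∈ relations := by
  have hmemG : ∀ z ∈ r.domain, Fin.init z ∈ G := fun z hz => by
    rw [hr] at hz
    exact hz.1
  have hsnoc_mem : ∀ y ∈ G, ∀ t ∈ Icc (a y) (b y), (Fin.snoc y t : Fin (m + 1) → ℝ) ∈ r.domain := by
    intro y hy t ht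
    rw [hr, KZlog.snoc_mem_band]
    exact ⟨hy, ht⟩
  -- the fibre maps
  have hfib_deriv : ∀ y ∈ G, ∀ t ∈ Icc (a y) (b y),
      HasDerivAt (fun s : ℝ => ψ (Fin.snoc y s)) (ψs (Fin.snoc y t)) t := by
    intro y hy t ht
    have h := hψs _ (hsnoc_mem y hy t ht)
    simpa only [Fin.init_snoc, Fin.snoc_last] using h
  have hfib_cont : ∀ y ∈ G, ContinuousOn (fun s : ℝ => ψ (Fin.snoc y s)) (Icc (a y) (b y)) :=
    fun y hy t ht => (hfib_deriv y hy t ht).continuousAt.continuousWithinAt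
  have hfib_mono : ∀ y ∈ G, StrictMonoOn (fun s : ℝ => ψ (Fin.snoc y s)) (Icc (a y) (b y)) := by
    intro y hy
    refine strictMonoOn_of_deriv_pos (convex_Icc _ _) (hfib_cont y hy) fun t ht => ?_
    rw [interior_Icc] at ht
    have hd := hfib_deriv y hy t (Ioo_subset_Icc_self ht)
    rw [hd.deriv]
    exact hpos _ (hsnoc_mem y hy t (Ioo_subset_Icc_self ht))
  -- the substitution
  set Φ : (Fin (m + 1) → ℝ) → (Fin (m + 1) → ℝ) := fun z => Fin.snoc (Fin.init z) (ψ z) with hΦ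
  let Φ' : (Fin (m + 1) → ℝ) → (Fin (m + 1) → ℝ) →L[ℝ] (Fin (m + 1) → ℝ) := fun z =>
    ContinuousLinearMap.pi
      (Fin.lastCases (motive := fun _ => (Fin (m + 1) → ℝ) →L[ℝ] ℝ) (fderiv ℝ ψ z)
        (fun i => ContinuousLinearMap.proj (Fin.castSucc i)))
  have hΦ' : ∀ z w, Φ' z w = Fin.snoc (Fin.init w) (fderiv ℝ ψ z w) := by
    intro z w
    funext i
    refine Fin.lastCases ?_ (fun j => ?_) i
    · simp [Φ']
    · simp [Φ', Fin.init]
  -- the partial derivative along the last coordinate is `ψs`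
  have hlast : ∀ z ∈ r.domain, fderiv ℝ ψ z (Pi.single (Fin.last m) 1) = ψs z := by
    intro z hz
    have hγ : HasDerivAt (fun t : ℝ => (Fin.snoc (Fin.init z) t : Fin (m + 1) → ℝ))
        (Pi.single (Fin.last m) (1 : ℝ)) (z (Fin.last m)) := by
      rw [hasDerivAt_pi]
      intro i
      refine Fin.lastCases ?_ (fun j => ?_) i
      · simpa using hasDerivAt_id' (z (Fin.last m))
      · simpa [(Fin.castSucc_lt_last j).ne, Fin.init] using hasDerivAt_const (z (Fin.last m)) (z (Fin.castSucc j))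
    have h1 : HasDerivAt (fun t : ℝ => ψ (Fin.snoc (Fin.init z) t))
        (fderiv ℝ ψ z (Pi.single (Fin.last m) 1)) (z (Fin.last m)) := by
      have hψz : HasFDerivAt ψ (fderiv ℝ ψ z) (Fin.snoc (Fin.init z) (z (Fin.last m))) := by
        rw [Fin.snoc_init_self]
        exact (hψd z hz).hasFDerivAt
      exact hψz.comp_hasDerivAt (z (Fin.last m)) hγ
    exact h1.unique (hψs z hz)
  -- determinant
  have hdet : ∀ z ∈ r.domain, (Φ' z).det = ψs z := by
    intro z hz
    let E : (Fin m → ℝ) →ₗ[ℝ] (Fin (m + 1) → ℝ) :=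
      LinearMap.pi (Fin.lastCases (motive := fun _ => (Fin m → ℝ) →ₗ[ℝ] ℝ) 0
        (fun i => LinearMap.proj i))
    have hE : ∀ y, E y = Fin.snoc y 0 := by
      intro y
      funext i
      refine Fin.lastCases ?_ (fun j => ?_) i
      · simp [E]
      · simp [E]
    have h := LinearMap.det_of_snoc_init (Φ' z : (Fin (m + 1) → ℝ) →ₗ[ℝ] (Fin (m + 1) → ℝ))
      LinearMap.id ((fderiv ℝ ψ z : (Fin (m + 1) → ℝ) →ₗ[ℝ] ℝ).comp E)
      (fderiv ℝ ψ z (Pi.single (Fin.last m) 1)) (fun w => by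
        rw [ContinuousLinearMap.coe_coe, hΦ', LinearMap.id_apply, LinearMap.comp_apply,
          ContinuousLinearMap.coe_coe, hE]
        congr 1
        conv_lhs => rw [eq_snoc_init_zero_add m w]
        rw [map_add, map_smul, smul_eq_mul, mul_comm])
    rw [LinearMap.det_id, mul_one, hlast z hz] at h
    exact h
  -- derivative
  have hderiv : ∀ z ∈ r.domain, HasFDerivAt Φ (Φ' z) z := by
    intro z hz
    rw [hasFDerivAt_pi']
    intro i
    refine Fin.lastCases ?_ (fun j => ?_) i
    · have hfun : (fun x => Φ x (Fin.last m)) = ψ := by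
        funext x
        simp [hΦ]
      show HasFDerivAt (fun x => Φ x (Fin.last m)) _ z
      rw [hfun]
      refine (hψd z hz).hasFDerivAt.congr_fderiv (ContinuousLinearMap.ext fun w => ?_)
      simp [hΦ']
    · have hfun : (fun x => Φ x (Fin.castSucc j)) = fun x => x (Fin.castSucc j) := by
        funext x
        simp [hΦ, Fin.init]
      show HasFDerivAt (fun x => Φ x (Fin.castSucc j)) _ z
      rw [hfun]
      refine (hasFDerivAt_apply (Fin.castSucc j) z).congr_fderiv
        (ContinuousLinearMap.ext fun w => ?_)
      simp [hΦ', Fin.init]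
  refine changeOfVariablesRel_subset_relations ⟨m + 1, r, r', Φ, Φ', ?_, ?_, ?_, ?_, ?_, rfl⟩
  · -- semialgebraic map
    refine (isSemialgebraicMapOn_iff_forall_holds r.isSemialgebraic_domain).mpr fun i => ?_
    refine Fin.lastCases ?_ (fun j => ?_) i
    · exact hψ.congr fun z _ => by simp [hΦ]
    · exact (isSemialgebraicFunOn_aeval r.isSemialgebraic_domain
        (MvPolynomial.X (Fin.castSucc j))).congr fun z _ => by simp [hΦ, Fin.init]
  · exact fun z hz => (hderiv z hz).hasFDerivWithinAt
  · -- injective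
    intro z₁ hz₁ z₂ hz₂ h
    have hy : Fin.init z₁ = Fin.init z₂ := by
      have := congrArg Fin.init h
      simpa [hΦ] using this
    have hl : ψ z₁ = ψ z₂ := by
      have := congrFun h (Fin.last m)
      simpa [hΦ] using this
    have hyG : Fin.init z₂ ∈ G := hmemG z₂ hz₂
    have ht₁ : z₁ (Fin.last m) ∈ Icc (a (Fin.init z₂)) (b (Fin.init z₂)) := by
      rw [hr] at hz₁; rw [← hy]; exact hz₁.2
    have ht₂ : z₂ (Fin.last m) ∈ Icc (a (Fin.init z₂)) (b (Fin.init z₂)) := by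
      rw [hr] at hz₂; exact hz₂.2
    have hl' : ψ (Fin.snoc (Fin.init z₂) (z₁ (Fin.last m))) = ψ (Fin.snoc (Fin.init z₂) (z₂ (Fin.last m))) := by
      rw [Fin.snoc_init_self]
      conv_lhs => rw [← hy, Fin.snoc_init_self]
      exact hl
    have hs : z₁ (Fin.last m) = z₂ (Fin.last m) := (hfib_mono _ hyG).injOn ht₁ ht₂ hl'
    rw [← Fin.snoc_init_self z₁, ← Fin.snoc_init_self z₂, hy, hs]
  · -- image
    rw [hr']
    ext w
    simp only [mem_image]
    constructor
    · intro hw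
      rw [KZlog.mem_band] at hw
      obtain ⟨hy, hw1, hw2⟩ := hw
      have hab' := hab _ hy
      have hivt := intermediate_value_Icc hab' (hfib_cont _ hy)
      rw [ha _ hy, hb _ hy] at hivt
      obtain ⟨t, ht, hwt⟩ := hivt ⟨hw1, hw2⟩
      have hwt' : ψ (Fin.snoc (Fin.init w) t) = w (Fin.last m) := hwt
      refine ⟨Fin.snoc (Fin.init w) t, hsnoc_mem _ hy t ht, ?_⟩
      simp only [hΦ, Fin.init_snoc]
      rw [hwt', Fin.snoc_init_self]
    · rintro ⟨z, hz, rfl⟩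
      have hy : Fin.init z ∈ G := hmemG z hz
      have ht : z (Fin.last m) ∈ Icc (a (Fin.init z)) (b (Fin.init z)) := by
        rw [hr] at hz; exact hz.2
      have hmono := (hfib_mono _ hy).monotoneOn
      have haz : a (Fin.init z) ∈ Icc (a (Fin.init z)) (b (Fin.init z)) := left_mem_Icc.mpr (hab _ hy)
      have hbz : b (Fin.init z) ∈ Icc (a (Fin.init z)) (b (Fin.init z)) := right_mem_Icc.mpr (hab _ hy)
      have h1 := hmono haz ht ht.1
      have h2 := hmono ht hbz ht.2
      simp only [ha _ hy, hb _ hy, Fin.snoc_init_self] at h1 h2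
      rw [KZlog.mem_band]
      simp only [hΦ, Fin.init_snoc, Fin.snoc_last]
      exact ⟨hy, h1, h2⟩
  · intro z hz
    rw [hint z hz, hdet z hz, abs_of_pos (hpos z hz)]


/-! ### Two instances of the fibred substitution -/


end KZ

end Literature.NumberTheory.Transcendental
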